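import Summits.Ventures.PercRepro.RankLevelSetAbsorbStarNullity

/-! # RankLevelSetAbsorbStarNullityGen — (ABS-star) AT EVERY STEP `k` WITH `#E ≥ (ν − 1)·k + 1` ON COLOOP-FREE
MATROIDS OF NULLITY `ν`, AT EVERY ELEMENT IN NO PARALLEL PAIR (night-1 g36; dossier §48.14 (iv); on
`RankLevelSetAbsorbStarNullity`)

The single up-shadow step per circuit of `RankLevelSetAbsorbStarNullity` with the hyperplane rank `ρ = ν − 1` in
place of `2`: the coefficient comparison `s(#E − 1 − k) ≥ #E − 1 − 2k + kρ` holds for `s ≥ 2` as soon as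
`#E ≥ kρ + 1` (**`absorbStar_perCircuit_of_eRank_dual`**), and summing over the circuits gives
**`absorbStar_step_of_eRank_dual`**: `(∀ e, ¬ IsColoop e) → (∀ z ≠ y, y ∉ cl {z}) → rk M✶ ≤ ρ + 1 → 1 ≤ ρ → 3 ≤ k →
2k + 1 ≤ #E → kρ + 1 ≤ #E → (#E − 1 − k) · A^y_k ≤ k · A^y_{k+1}`. For `ρ = 2` this is `absorbStar_step_of_nullity`;
for `ρ = k − 1` it contains g34's `absorbStar_step_of_sq` (`#E ≥ k² − k + 1`) on coloop-free matroids — the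
per-circuit single step is their common generalisation. Every declaration has a docstring; imports: the cell's own
modules and Mathlib only. Axioms: standard. -/

namespace PercRepro

open Set Matroid

variable {α : Type} (M : Matroid α) [M.Finite]

/-! ## The per-circuit step with a general hyperplane rank -/

/-- **THE PER-CIRCUIT STEP OF (ABS-star) WHEN `rk M✶ ≤ ρ + 1` AND `#E ≥ kρ + 1`** (coloop-free `M`, `y` in no
parallel pair, `1 ≤ ρ`, `3 ≤ k`, `2k + 1 ≤ #E`): `(#E − 1 − k) · #members(K, k) ≤ k · #members(K, k + 1)` — one
up-shadow step with the hyperplane rank `ρ`; the coefficients compare as `s(#E − 1 − k) ≥ #E − 1 − 2k + kρ`, which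
`s ≥ 2` and `#E ≥ kρ + 1` give. -/
theorem absorbStar_perCircuit_of_eRank_dual (hcol : ∀ e, ¬ M.IsColoop e) {y : α} (hy : y ∈ M.E)
    (hnp : ∀ z, z ≠ y → y ∉ M.closure {z}) {ρ : ℕ} (hν : M✶.eRank ≤ ρ + 1) (hρ1 : 1 ≤ ρ) {k : ℕ} (hk3 : 3 ≤ k)
    (hk : 2 * k + 1 ≤ M.E.ncard) (hkρ : k * ρ + 1 ≤ M.E.ncard) {Z₀ : Set α} (hZ₀ : Z₀ ∈ lowAbsorbAt M y k) :
    (M.E.ncard - 1 - k) * {Z ∈ lowAbsorbAt M y k | M.fundCircuit y Z = M.fundCircuit y Z₀}.ncard ≤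
      k * {Z ∈ lowAbsorbAt M y (k + 1) | M.fundCircuit y Z = M.fundCircuit y Z₀}.ncard := by
  obtain ⟨hKeq, hSZ, hSE, hHE, -, -, hHy, hyH, hnl, -⟩ := circuit_dual_facts M hcol hy hZ₀
  have h1 := members_le_fam M hy hZ₀
  have h2 := fam_le_absorb M hy hZ₀ (k + 1 - (M.fundCircuit y Z₀ \ {y}).ncard)
  obtain ⟨z₀, hz₀⟩ : (M.E \ {y}).Nonempty := by
    rw [← Set.ncard_pos (M.ground_finite.subset Set.sdiff_subset), Set.ncard_sdiff_singleton_of_mem hy]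
    omega
  have hz₀y : z₀ ≠ y := by simpa using hz₀.2
  have hK3 := (fundCircuit_ncard_absorb M hy hnp hz₀y hZ₀).1
  have hZE : Z₀ ⊆ M.E := hZ₀.1.1
  have hZk : Z₀.ncard = k := hZ₀.1.2.1
  set K := M.fundCircuit y Z₀ with hK'
  set S := K \ {y} with hS
  set H := M.E \ K with hH
  have hyK : y ∈ K := M.mem_fundCircuit y Z₀
  have hKE : K ⊆ M.E := hKeq ▸ Set.insert_subset hy hSE
  have hKfin : K.Finite := M.ground_finite.subset hKE
  have hKcard : K.ncard = S.ncard + 1 := by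
    rw [hS, Set.ncard_sdiff_singleton_of_mem hyK]
    have : 1 ≤ K.ncard := (Set.ncard_pos hKfin).mpr ⟨y, hyK⟩
    omega
  have hKle : K.ncard ≤ M.E.ncard := Set.ncard_le_ncard hKE M.ground_finite
  have hHcard : H.ncard + K.ncard = M.E.ncard := by
    rw [hH, Set.ncard_sdiff hKE hKfin]; omega
  have hsk : S.ncard ≤ k := by
    rw [← hZk]; exact Set.ncard_le_ncard hSZ (M.ground_finite.subset hZE)
  have hyE' : y ∈ M✶.E := by rwa [Matroid.dual_ground]
  have hHE' : H ⊆ M✶.E := by rwa [Matroid.dual_ground]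
  have hSE' : S ⊆ M✶.E := by rwa [Matroid.dual_ground]
  have hρ : M✶.eRk H ≤ ((ρ : ℕ) : ℕ∞) := by
    have h : M✶.eRk H + 1 ≤ ((ρ : ℕ) : ℕ∞) + 1 := by
      rw [eRk_add_one_eq_eRank_of_spanning_insert hyE' hyH hHy]
      exact_mod_cast hν
    exact (WithTop.add_le_add_iff_right (by decide)).mp h
  have hs2 : 2 ≤ S.ncard := by omega
  -- the bookkeeping: `k = s + d`, `ρ = 1 + ρ'`, `#E − 1 − k = a ≥ kρ'`, `a = c + ρ'`, `#H = a + d`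
  obtain ⟨d, hd⟩ := Nat.exists_eq_add_of_le hsk
  obtain ⟨ρ', hρ'⟩ := Nat.exists_eq_add_of_le hρ1
  obtain ⟨a, ha⟩ : ∃ a, M.E.ncard - 1 - k = a := ⟨_, rfl⟩
  have hkρ2 : k * ρ' + k + 1 ≤ M.E.ncard := by
    have : k * ρ = k * ρ' + k := by rw [hρ', Nat.mul_add, Nat.mul_one, Nat.add_comm]
    omega
  have hka : k * ρ' ≤ a := by omega
  have h3ρ : 3 * ρ' ≤ k * ρ' := Nat.mul_le_mul_right ρ' hk3
  obtain ⟨c, hc⟩ : ∃ c, a = c + ρ' := ⟨a - ρ', by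
    have : ρ' ≤ k * ρ' := Nat.le_mul_of_pos_left ρ' (by omega)
    omega⟩
  have hside : k - S.ncard + ρ < H.ncard := by omega
  have hstep := absorbFam_step (S := S) hHE' hSE' hyE' hyH hHy hnl hρ hρ1
    (i := k - S.ncard) hside
  have e1 : k + 1 - S.ncard = k - S.ncard + 1 := by omega
  rw [e1] at h2
  set f : ℕ → ℕ := fun i =>
    {X | X ⊆ H ∧ X.ncard = i ∧ M✶.Spanning (S ∪ X) ∧ M✶.Spanning (insert y (H \ X))}.ncard with hf
  have hstep' : (H.ncard - (k - S.ncard) - (ρ - 1)) * f (k - S.ncard) ≤ (k - S.ncard + 1) * f (k - S.ncard + 1) :=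
    hstep
  -- arithmetic: `(n − 1 − k) · m ≤ (n − 1 − k) · f i`, `f i · (h − i − 1) ≤ (i + 1) · f (i + 1)`, `f (i + 1) ≤ t`
  have hm : {Z ∈ lowAbsorbAt M y k | M.fundCircuit y Z = K}.ncard ≤ f (k - S.ncard) := h1
  have ht : f (k - S.ncard + 1) ≤ {Z ∈ lowAbsorbAt M y (k + 1) | M.fundCircuit y Z = K}.ncard := by
    have := h2
    rwa [show k - S.ncard + 1 + S.ncard = k + 1 by omega] at this
  -- `(n − 1 − k) · (i + 1) ≤ k · (h − i − (ρ − 1))` where `i = k − s`, `h = n − 1 − s`: this is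
  -- `(c + ρ')(d + 1) ≤ k · c` with `c ≥ (k − 1)ρ' ≥ (d + 1)ρ'` (`s ≥ 2`)
  have hcoef : (M.E.ncard - 1 - k) * (k - S.ncard + 1) ≤ k * (H.ncard - (k - S.ncard) - (ρ - 1)) := by
    obtain ⟨s', hs'⟩ := Nat.exists_eq_add_of_le hs2
    have e1 : M.E.ncard - 1 - k = c + ρ' := by omega
    have e2 : k - S.ncard + 1 = d + 1 := by omega
    have e3 : H.ncard - (k - S.ncard) - (ρ - 1) = c := by omega
    have hc2 : (2 + s' + d) * ρ' ≤ c + ρ' := by rw [← hs', ← hd]; omega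
    rw [e1, e2, e3, hd, hs']
    nlinarith [hc2, Nat.zero_le (s' * c), Nat.zero_le (s' * ρ')]
  have key : (k - S.ncard + 1) * ((M.E.ncard - 1 - k) * f (k - S.ncard)) ≤
      (k - S.ncard + 1) * (k * f (k - S.ncard + 1)) := by
    calc (k - S.ncard + 1) * ((M.E.ncard - 1 - k) * f (k - S.ncard))
        = ((M.E.ncard - 1 - k) * (k - S.ncard + 1)) * f (k - S.ncard) := by ring
      _ ≤ (k * (H.ncard - (k - S.ncard) - (ρ - 1))) * f (k - S.ncard) := Nat.mul_le_mul_right _ hcoef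
      _ = k * ((H.ncard - (k - S.ncard) - (ρ - 1)) * f (k - S.ncard)) := by ring
      _ ≤ k * ((k - S.ncard + 1) * f (k - S.ncard + 1)) := Nat.mul_le_mul_left _ hstep'
      _ = (k - S.ncard + 1) * (k * f (k - S.ncard + 1)) := by ring
  have key' := Nat.le_of_mul_le_mul_left key (by omega)
  calc (M.E.ncard - 1 - k) * {Z ∈ lowAbsorbAt M y k | M.fundCircuit y Z = K}.ncard
      ≤ (M.E.ncard - 1 - k) * f (k - S.ncard) := Nat.mul_le_mul_left _ hm
    _ ≤ k * f (k - S.ncard + 1) := key'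
    _ ≤ k * {Z ∈ lowAbsorbAt M y (k + 1) | M.fundCircuit y Z = K}.ncard := Nat.mul_le_mul_left _ ht

/-- **(ABS-star) AT EVERY STEP `k ≥ 3` WITH `#E ≥ kρ + 1` ON A COLOOP-FREE MATROID WITH `rk M✶ ≤ ρ + 1`, AT AN
ELEMENT IN NO PARALLEL PAIR** (`2k + 1 ≤ #E`): `(#E − 1 − k) · A^y_k ≤ k · A^y_{k+1}`. -/
theorem absorbStar_step_of_eRank_dual (hcol : ∀ e, ¬ M.IsColoop e) {y : α} (hy : y ∈ M.E)
    (hnp : ∀ z, z ≠ y → y ∉ M.closure {z}) {ρ : ℕ} (hν : M✶.eRank ≤ ρ + 1) (hρ1 : 1 ≤ ρ) {k : ℕ} (hk3 : 3 ≤ k)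
    (hk : 2 * k + 1 ≤ M.E.ncard) (hkρ : k * ρ + 1 ≤ M.E.ncard) :
    (M.E.ncard - 1 - k) * lowAbsorbCount M y k ≤ k * lowAbsorbCount M y (k + 1) := by
  unfold lowAbsorbCount
  exact absorbStar_step_of_perCircuit M k (M.E.ncard - 1 - k) k
    (fun Z₀ hZ₀ => absorbStar_perCircuit_of_eRank_dual M hcol hy hnp hν hρ1 hk3 hk hkρ hZ₀)

/-- **(ABS-star) AT EVERY STEP `k` WITH `#E ≥ 3k + 1` ON A COLOOP-FREE MATROID OF NULLITY `≤ 4`, AT AN ELEMENT IN NO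
PARALLEL PAIR** (`ρ = 3`; the steps `k ≤ 3` are `absorbStar_of_le_three_all`). -/
theorem absorbStar_step_of_nullity_four (hcol : ∀ e, ¬ M.IsColoop e) {y : α} (hy : y ∈ M.E)
    (hnp : ∀ z, z ≠ y → y ∉ M.closure {z}) (hν : M✶.eRank ≤ 4) {k : ℕ} (hk3 : 3 ≤ k)
    (hk : 3 * k + 1 ≤ M.E.ncard) :
    (M.E.ncard - 1 - k) * lowAbsorbCount M y k ≤ k * lowAbsorbCount M y (k + 1) :=
  absorbStar_step_of_eRank_dual M hcol hy hnp (ρ := 3) (by exact_mod_cast hν) (by norm_num) hk3 (by omega)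
    (by omega)

end PercRepro
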